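import Summits.AnomalousDissipation.AnomalousDissipation.Theses.Sparks
import Literature.Analysis.FluidPDE.DissipationAnomalyProofs

/-!
# Crux `SingularitiesDissipate` (stmt-AnomalousDissipation-1185, route Sparks, rank 3) — birth skeleton

`Lines/birth.lean` (BC3): three NAMED stubs and the kernel-checked composition
`SingularitiesDissipate_of : stub₁ → stub₂ → stub₃ → SingularitiesDissipate` concluding the route decl
`Summit.AnomalousDissipation.AnomalousDissipation.Theses.Sparks.SingularitiesDissipate` BY NAME (hypotheses =
the name-keyed aliases `__Registered.stub_*`, textually the stub signatures; sorries ONLY inside the three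
`stub_*`; hypothesis-free `SingularitiesDissipate_skeleton` at the end).

## The crux

`SingularitiesDissipate` (the hinge of route Sparks): for a smooth steady divergence-free mean-zero force
`f` on `T³`, a smooth divergence-free state `U₀` and `T > 0` such that smooth-forced Euler from `U₀` has NO
classical solution on `[0,T]` (breakdown by `T`), there are a quantum `q > 0`, a delay `τ ≥ 0`, a threshold
`ν₀ > 0` and a radius `δ > 0` such that EVERY global Leray–Hopf solution `u` of `NS_ν`, `0 < ν < ν₀`, forced
by `f`, from a finite-energy datum `u₀` with `‖u₀ − U₀‖_{L²} ≤ δ`, burns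
`q ≤ ν ∫₀^{T+τ} ‖∇u‖₂²` (spectral `eGradNormSq`, the integrand of `meanDissipation`).

## The cut: LIFESPAN ∣ SINGULARITIES DRAIN ENERGY ∣ THE DRAIN IS VISCOUS

The barrier catalogued against this crux
(`Literature.Barriers.AnomalousDissipation.Cheskidov2023_thm21_noDissipationAnomaly`, Cheskidov
arXiv:2311.04182 Thm. 2.1: anomalous dissipation of the limit WITHOUT dissipation anomaly — the family keeps
its energy, parked at frequency `5^m` where `ν_m = m⁻¹5^{−2m}` cannot burn it before the window ends)
records (audit 2026-08-15) that on a finite window the alternative "the energy is drained (and then the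
only question is through which channel)" versus "the energy stays in the family, escaping to high frequency
unburnt" is EXHAUSTIVE, and that a route must say on which side it stands. The skeleton cuts the crux
exactly along that line, after first giving the breakdown hypothesis its structure:

* `stub_maximalLifespan` (KNOWN MATHEMATICS, provable in principle, size L–XL in Lean): breakdown by `T`
  ⇒ a maximal classical forced-Euler solution `(U, P)` on `[0, T⋆)`, `0 < T⋆ ≤ T`, from `U₀`, which
  cannot be continued to the closed interval `[0, T⋆]` (no classical solution on `Icc 0 T⋆` from `U₀`).
  Content: local well-posedness of smooth-forced Euler on `T³` in `C^∞` (Kato 1972 / Bourguignon–Brezis 1974 /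
  Ebin–Marsden 1970; Majda–Bertozzi 2002 Thm. 3.4 + Cor. 3.1 for uniqueness; the `C^∞` lifespan equals the
  `H^s` lifespan by Beale–Kato–Majda 1984), uniqueness by the energy method, gluing of classical solutions
  (`Literature.Analysis.FunctionSpaces.TorusClassicalNSGluing` patterns), and the supremum argument.
* `stub_blowupDrainsEnergy` (OPEN — the Onsager side; the hardest stub): a maximal classical solution that
  breaks down at `T⋆` IGNITES AN ENERGY DEFICIT: there are `q > 0`, `τ ≥ 0`, `ν₀ > 0`, `δ > 0` such that every
  global Leray–Hopf solution (`ν < ν₀`, finite-energy datum `δ`-close to `U₀` in `L²`) has, at SOME time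
  `t ∈ [T⋆, T⋆ + τ]`, kinetic energy at least `q` BELOW the conservative budget:
  `E(u(t)) + q ≤ E(u₀) + ∫₀ᵗ ∫ f·u`. By the Leray–Hopf energy inequality this is a CONSEQUENCE of the crux
  (burn `≥ q` on `(0, t)` forces a deficit `≥ q` at `t`), strictly weaker: it does not say where the energy
  went (viscous burn, Leray–Hopf slack, or — at fixed `ν` impossible for long, but possible for a window —
  nowhere: the Cheskidov family keeps `‖u^{ν}(t)‖₂ → 1`, i.e. has NO deficit, which is how the barrier bites
  THIS stub and not the next). The bet: a genuine smooth-data singularity under a steady smooth 3-D force does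
  not park its energy in a finite frequency band for a `ν`-independent time; it cascades and the kinetic
  energy of the viscous flows actually drops (Onsager's "ideal turbulence at a singular event";
  Kolmogorov's `ν`-independent cascade time).
* `stub_deficitIsViscous` (OPEN BUT PHYSICALLY UNCONTROVERSIAL — the Leray side; size L): uniform
  APPROXIMATE ENERGY EQUALITY of Leray–Hopf solutions near smooth data: for every window `S` and tolerance
  `ε > 0` there are `ν₀, δ > 0` such that every global Leray–Hopf solution (`ν < ν₀`, finite-energy datum
  `δ`-close to the smooth `U₀`) satisfies `E(u₀) + ∫₀ᵗ∫ f·u ≤ E(u(t)) + ν∫₀ᵗ‖∇u‖₂² + ε` for all `0 < t ≤ S`: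
  at fixed viscosity the ONLY energy sink is the viscous one, up to `ε`. (The reverse inequality is the
  Leray–Hopf energy inequality `energy_ineq_zero`.) Open because the energy EQUALITY for 3-D Leray–Hopf
  solutions is open (Lions 1960 / Shinbrot 1974 give it under `L⁴L⁴`-type integrability; the slack of a
  hypothetical wild Leray–Hopf solution is not known to be small), and because of the uniformity in `ν → 0`;
  the slice `t = 0` is EXCLUDED (`Ioc 0 S`): the `t = 0` slice of `Torus.IsLerayHopfOn` is junk (negatives
  index: RobustDecayQuantum, stmt-AnomalousDissipation-2859), `u 0` being constrained only by
  `E(u 0) ≤ E(u₀)`.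

Composition (`SingularitiesDissipate_of`, no sorry): breakdown by `T` ⇒ (stub 1) maximal solution on
`[0,T⋆)`, `T⋆ ≤ T`, not continuable to `[0,T⋆]` ⇒ (stub 2) `q, τ, ν₁, δ₁` and, per solution, a deficit time
`t ∈ [T⋆, T⋆+τ] ⊆ (0, T+τ]` ⇒ (stub 3 with `S = T + τ`, `ε = q/2`) `ν∫₀ᵗ‖∇u‖² ≥ q/2` ⇒ (monotonicity of the
window, using finiteness of `∫₀^{T+τ}‖∇u‖₂²` for Leray–Hopf solutions,
`Literature.Analysis.FluidPDE.Torus.IsLerayHopfOn.lintegral_eGradNormSq_lt_top`) the crux with witnesses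
`(q/2, τ, min ν₁ ν₂, min δ₁ δ₂)`.

Disproof used: none relevant — `ledger crux ls stmt-AnomalousDissipation-1185` showed NO workfiles (no
`Disproof.lean`, no `Negative/` lemma, no ideas, no lines) at registration (2026-08-17). Negatives honoured:
RobustDecayQuantum (2859, junk `t = 0` slice) — stub 3 quantifies `t ∈ Ioc 0 S`, stub 2 `t ≥ T⋆ > 0`;
GPEnergyCeiling (2979, no universal energy ceiling) — not touched (no ceiling is claimed). No stub is an
instance of a refuted statement (the refuted items of the summit concern correlation/Taylor certificates,
frustrated forces, debris quanta, 2½-D families and energy ceilings, none an energy-(in)equality statement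
for Leray–Hopf solutions near smooth data).

Hardest stub: `stub_blowupDrainsEnergy` — it is the crux's open content minus the channel question; its
recorded failure modes are the crux's (mild, energy-conservative singular continuations `C^{α}`, `α > 1/3`,
Onsager-subcritical, drain nothing; escape to a finite frequency band for the whole delay window, Cheskidov
2023 Thm. 2.1 / Thm. 2.5; `L²`-small gradient-large perturbations defusing the singularity). Sources:
Cheskidov2023 (arXiv:2311.04182) Thm. 2.1/2.5 and §1.1; DrivasEyink2019 Thm. 2; BrueDeLellis2023 §1 and App.
Lemma 7; BrenierDeLellisSzekelyhidi2011 Cor. 1; arXiv:1310.8611; Kato1972; BealeKatoMajda1984;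
MajdaBertozzi2002 Thm. 3.4, Cor. 3.1; Leray1934 (5.2); Galdi2000 Def. 2.1 / §4; Lions1960; Shinbrot1974.
-/

-- `Summit.<Summit>.<Problem>`: single-conjunct summit, the duplicate component is the tree's convention.
set_option linter.dupNamespace false

noncomputable section

open Filter Set MeasureTheory Topology

namespace Summit.AnomalousDissipation.AnomalousDissipation.Cruxes.SingularitiesDissipate.Birth

/-- **stub 1 — MAXIMAL LIFESPAN of smooth steadily-forced Euler on `T³` (known mathematics; size L–XL in
Lean).** If the Euler equations on `T³` forced by the smooth steady divergence-free mean-zero `f` admit NO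
classical solution on `[0, T]` from the smooth divergence-free `U₀` (`T > 0`), then there is a breakdown time
`0 < T⋆ ≤ T` carrying a classical solution `(U, P)` on the half-open `[0, T⋆)` with `U 0 = U₀`
(`Torus.IsClassicalNSSolutionOn (Ico 0 T⋆) 0 (fun _ => f) U P`) that cannot be continued to the closed
interval: no classical solution on `Icc 0 T⋆` has datum `U₀`. Why true: local existence of `C^∞` solutions
of smooth-forced Euler on the flat torus from `C^∞` divergence-free data (Kato 1972; Bourguignon–Brezis 1974;
Ebin–Marsden 1970; Majda–Bertozzi 2002 Thm. 3.4 on `ℝ³`, periodic case identical), with smooth pressure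
from `Δp = div f − div((U·∇)U)`; uniqueness of classical solutions (energy method, Majda–Bertozzi 2002
Cor. 3.1); the `C^∞` lifespan is the `H^s` lifespan (`s > 5/2`; Beale–Kato–Majda 1984); let
`T⋆ := sup {t : a classical solution from U₀ exists on [0,t]}` (`> 0` by local existence, `≤ T` by the
hypothesis and restriction `IsClassicalNSSolutionOn.mono`); glue the unique solutions on `[0,t]`, `t < T⋆`,
into one on `[0,T⋆)`; a classical solution on `[0,T⋆]` would restart from the smooth state `U(T⋆)` and
continue past `T⋆` (gluing as in `Literature.Analysis.FunctionSpaces.TorusClassicalNSGluing`), contradicting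
the supremum (or, if `T⋆ = T`, the hypothesis). Why it might fail: it should not; the Lean cost is the local
`C^∞` theory of forced Euler on `T³` (not yet a tree fact: the tree has the whole-space unforced
`Literature.Analysis.FluidPDE.MajdaBertozzi2002_localExistenceH3` and the continuation vocabulary
`Literature.Analysis.FluidPDE.IsMaximalSmoothSolution` on `E`, not on the torus). Sources: Kato1972,
BourguignonBrezis1974, EbinMarsden1970, MajdaBertozzi2002 (Thm. 3.4, Cor. 3.1), BealeKatoMajda1984 §1. -/
theorem stub_maximalLifespan :
    ∀ f : UnitAddTorus (Fin 3) → EuclideanSpace ℝ (Fin 3), Literature.Analysis.FunctionSpaces.Torus.IsSmooth f → Literature.Analysis.FunctionSpaces.Torus.IsDivFree f → Literature.Analysis.FunctionSpaces.Torus.HasZeroMean f → ∀ (U₀ : UnitAddTorus (Fin 3) → EuclideanSpace ℝ (Fin 3)), Literature.Analysis.FunctionSpaces.Torus.IsSmooth U₀ → Literature.Analysis.FunctionSpaces.Torus.IsDivFree U₀ → ∀ (T : ℝ), 0 < T → (∀ (U : ℝ → UnitAddTorus (Fin 3) → EuclideanSpace ℝ (Fin 3)) (P : ℝ → UnitAddTorus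 (Fin 3) → ℝ), Literature.Analysis.FunctionSpaces.Torus.IsClassicalNSSolutionOn (Set.Icc 0 T) 0 (fun _ => f) U P → U 0 ≠ U₀) → ∃ Ts : ℝ, 0 < Ts ∧ Ts ≤ T ∧ (∃ (U : ℝ → UnitAddTorus (Fin 3) → EuclideanSpace ℝ (Fin 3)) (P : ℝ → UnitAddTorus (Fin 3) → ℝ), Literature.Analysis.FunctionSpaces.Torus.IsClassicalNSSolutionOn (Set.Ico 0 Ts) 0 (fun _ => f) U P ∧ U 0 = U₀) ∧ ∀ (V : ℝ → UnitAddTorus (Fin 3) → EuclideanSpace ℝ (Fin 3)) (Q : ℝ → UnitAddTorus (Fin 3) → ℝ), Literature.Analysis.FunctionSpaces.Torus.IsClassicalNSSolutionOn (Set.Icc 0 Ts) 0 (fun _ => f) V Q → V 0 ≠ U₀ := by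
  sorry

/-- **stub 2 — SINGULARITIES DRAIN ENERGY (open; the Onsager side of the hinge; the hardest stub).** Let
`f` be smooth steady divergence-free mean-zero, `U₀` smooth divergence-free, and let `(U, P)` be a classical
forced-Euler solution on `[0, T⋆)`, `T⋆ > 0`, with `U 0 = U₀` that cannot be continued to `[0, T⋆]` (no
classical solution on `Icc 0 T⋆` from `U₀`: breakdown AT `T⋆`). Then there are `q > 0`, `τ ≥ 0`, `ν₀ > 0`,
`δ > 0` such that EVERY global Leray–Hopf solution `u` of `NS_ν`, `0 < ν < ν₀`, forced by `f`, from a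
finite-energy datum `u₀` with `‖u₀ − U₀‖_{L²} ≤ δ`, shows at SOME time `t ∈ [T⋆, T⋆ + τ]` an ENERGY DEFICIT
of at least `q` against the conservative budget:
`kineticEnergy (u t) + q ≤ kineticEnergy u₀ + ∫₀ᵗ ∫ ⟪f, u⟫`.
(For `t > 0` the slice `u t` is the canonical weakly continuous one and lies in `L²`, `IsLerayHopfOn.memLp`;
the power `s ↦ ∫⟪f, u s⟫` is continuous on `(0, t]` by `weak_continuous`, so the interval integral is
genuine.) Relation to the crux: by `energy_ineq_zero`, burn `≥ q` on `(0,t)` gives deficit `≥ q` at `t`, so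
this is IMPLIED by `SingularitiesDissipate` (with stub 1) and strictly weaker — it is silent on the channel
(viscous burn vs. Leray–Hopf slack), which is stub 3. Why plausibly true: a smooth-data singularity of
steadily forced 3-D Euler should trigger a cascade whose time to reach the dissipative scale is
`ν`-independent (Kolmogorov), so within a fixed delay `τ` the viscous flows that shadow the Euler solution up
to `T⋆` (weak–strong tracking, BrueDeLellis2023 App. Lemma 7 / BrenierDeLellisSzekelyhidi2011 Cor. 1) lose a
`ν`-independent quantum of kinetic energy (Onsager 1949's ideal turbulence at a singular event; dissipative
anomalies need Onsager-critical roughness, DrivasEyink2019 Thm. 2, and a genuine blow-up supplies roughness of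
every order). Why it might fail: (i) the singular continuation may be MILD — a `C^{α}`, `α > 1/3`, hence
energy-CONSERVATIVE non-classical Euler flow shadowed by the viscous family with no deficit at all (the crux's
"non-atomic collapse burns nothing AT `T⋆`"; the delay `τ` only helps if roughening continues); (ii) ESCAPE
WITHOUT DRAIN for the whole window: the family may move its energy to a frequency band `K ≪ k ≪ (ντ)^{-1/2}`
and keep it there, exactly as the Cheskidov family keeps `‖u^{ν}(t)‖₂ → 1` on `[1,2]`
(`Literature.Barriers.AnomalousDissipation.Cheskidov2023_thm21_noDissipationAnomaly`, arXiv:2311.04182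
Thm. 2.1; there the stirring stops at the singular time and the force is `ν`-dependent and only `C^{α<1}` in
the limit — the bet is that a STEADY smooth 3-D force cannot park energy `ν`-uniformly); (iii) `L²`-small,
gradient-large perturbations of the datum defusing the singularity (the quantifier is over ALL `δ`-close
finite-energy data). Sources: Cheskidov2023 Thm. 2.1/2.5, §1.1; DrivasEyink2019; BrueDeLellis2023 §1, App.
Lemma 7; BrenierDeLellisSzekelyhidi2011 Cor. 1; arXiv:1310.8611; Onsager1949. -/
theorem stub_blowupDrainsEnergy :
    ∀ f : UnitAddTorus (Fin 3) → EuclideanSpace ℝ (Fin 3), Literature.Analysis.FunctionSpaces.Torus.IsSmooth f → Literature.Analysis.FunctionSpaces.Torus.IsDivFree f → Literature.Analysis.FunctionSpaces.Torus.HasZeroMean f → ∀ (U₀ : UnitAddTorus (Fin 3) → EuclideanSpace ℝ (Fin 3)), Literature.Analysis.FunctionSpaces.Torus.IsSmooth U₀ → Literature.Analysis.FunctionSpaces.Torus.IsDivFree U₀ → ∀ (Ts : ℝ), 0 < Ts → ∀ (U : ℝ → UnitAddTorus (Fin 3) → EuclideanSpace ℝ (Fin 3)) (P : ℝ → UnitAddTorus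 (Fin 3) → ℝ), Literature.Analysis.FunctionSpaces.Torus.IsClassicalNSSolutionOn (Set.Ico 0 Ts) 0 (fun _ => f) U P → U 0 = U₀ → (∀ (V : ℝ → UnitAddTorus (Fin 3) → EuclideanSpace ℝ (Fin 3)) (Q : ℝ → UnitAddTorus (Fin 3) → ℝ), Literature.Analysis.FunctionSpaces.Torus.IsClassicalNSSolutionOn (Set.Icc 0 Ts) 0 (fun _ => f) V Q → V 0 ≠ U₀) → ∃ (q τ ν₀ δ : ℝ), 0 < q ∧ 0 ≤ τ ∧ 0 < ν₀ ∧ 0 < δ ∧ ∀ (ν : ℝ) (u₀ : UnitAddTorus (Fin 3) → EuclideanSpace ℝ (Fin 3)) (u : ℝ → UnitAddTorus (Fin 3) → EuclideanSpace ℝ (Fin 3)), 0 < ν → ν < ν₀ → Literature.Analysis.FluidPDE.Torus.IsGlobalLerayHopf ν (fun _ => f) u₀ u → MeasureTheory.MemLp u₀ 2 MeasureTheory.volume → MeasureTheory.eLpNorm (u₀ - U₀) 2 MeasureTheory.volume ≤ ENNReal.ofReal δ → ∃ t ∈ Set.Icc Ts (Ts + τ), Literature.Analysis.FunctionSpaces.Torus.kineticEnergy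 (u t) + q ≤ Literature.Analysis.FunctionSpaces.Torus.kineticEnergy u₀ + ∫ s in (0:ℝ)..t, ∫ x, inner ℝ (f x) (u s x) := by
  sorry

/-- **stub 3 — THE DRAIN IS VISCOUS: uniform approximate energy equality of Leray–Hopf solutions near smooth
data (open, physically uncontroversial; the Leray side of the hinge; size L).** Let `f` be smooth steady
divergence-free mean-zero and `U₀` smooth divergence-free. For every window `S > 0` and tolerance `ε > 0`
there are `ν₀ > 0` and `δ > 0` such that every global Leray–Hopf solution `u` of `NS_ν`, `0 < ν < ν₀`, forced
by `f`, from a finite-energy datum `u₀` with `‖u₀ − U₀‖_{L²} ≤ δ`, satisfies for all `0 < t ≤ S`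
`kineticEnergy u₀ + ∫₀ᵗ ∫ ⟪f, u⟫ ≤ kineticEnergy (u t) + ν ∫₀ᵗ ‖∇u‖₂² + ε`
(spectral `eGradNormSq`, `lintegral` on `Ioo 0 t` with `toReal`, finite by
`IsLerayHopfOn.lintegral_eGradNormSq_lt_top`) — together with the Leray–Hopf energy INEQUALITY
`energy_ineq_zero` (the reverse direction, exact) this says: at fixed small viscosity, near smooth data, the
kinetic energy missing at time `t` has been burnt viscously, up to `ε`; no `ν`-uniform anomalous slack. The
slice `t = 0` is excluded on purpose (`Set.Ioc`): `u 0` is constrained by `Torus.IsLerayHopfOn` only through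
`kineticEnergy (u 0) ≤ kineticEnergy u₀` (negatives index: RobustDecayQuantum, stmt-AnomalousDissipation-2859),
whereas for `t > 0` the slice is the canonical weakly continuous representative. Why plausibly true: smooth
solutions satisfy the energy EQUALITY (`Torus.IsClassicalNSSolutionOn.energy_balance`), and so does every
Leray–Hopf solution with `u ∈ L⁴(0,S; L⁴)` (Lions 1960; Shinbrot 1974 `L^pL^q`, `2/p + 2/q ≤ 1`, `q ≥ 4`;
Cheskidov–Constantin–Friedlander–Shvydkoy 2008: `L³B^{1/3}_{3,c₀}`) — physically the Navier–Stokes flow at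
fixed `ν > 0` has no energy sink but viscosity, the slack of the Leray–Hopf inequality being an artefact of
the compactness construction; the rough part of the datum carries energy `O(δ‖U₀‖₂ + δ²)`, absorbed by `ε`.
Why it might fail: the energy equality for 3-D Leray–Hopf solutions is OPEN at each fixed `ν` (a wild
Leray–Hopf solution with `O(1)` anomalous slack from smooth-ish data — cf. the forced non-uniqueness of
Albritton–Brué–Colombo 2022 — would refute it), and the statement asks it UNIFORMLY as `ν → 0` through a
would-be singular event, where the `L⁴L⁴`-type criteria degenerate; Cheskidov 2023 Thm. 2.1 does NOT bite
(its family has no deficit at all at fixed `ν`: energy equality holds for its smooth members). Sources: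
Leray1934 (5.2); Lions1960; Shinbrot1974; CheskidovConstantinFriedlanderShvydkoy2008; Galdi2000 §4;
AlbrittonBrueColombo2022; Cheskidov2023 §1.1. -/
theorem stub_deficitIsViscous :
    ∀ f : UnitAddTorus (Fin 3) → EuclideanSpace ℝ (Fin 3), Literature.Analysis.FunctionSpaces.Torus.IsSmooth f → Literature.Analysis.FunctionSpaces.Torus.IsDivFree f → Literature.Analysis.FunctionSpaces.Torus.HasZeroMean f → ∀ (U₀ : UnitAddTorus (Fin 3) → EuclideanSpace ℝ (Fin 3)), Literature.Analysis.FunctionSpaces.Torus.IsSmooth U₀ → Literature.Analysis.FunctionSpaces.Torus.IsDivFree U₀ → ∀ (S : ℝ), 0 < S → ∀ (ε : ℝ), 0 < ε → ∃ (ν₀ δ : ℝ), 0 < ν₀ ∧ 0 < δ ∧ ∀ (ν : ℝ) (u₀ : UnitAddTorus (Fin 3) → EuclideanSpace ℝ (Fin 3)) (u : ℝ → UnitAddTorus (Fin 3) → EuclideanSpace ℝ (Fin 3)), 0 < ν → ν < ν₀ → Literature.Analysis.FluidPDE.Torus.IsGlobalLerayHopf ν (fun _ => f) u₀ u → MeasureTheory.MemLp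 u₀ 2 MeasureTheory.volume → MeasureTheory.eLpNorm (u₀ - U₀) 2 MeasureTheory.volume ≤ ENNReal.ofReal δ → ∀ t ∈ Set.Ioc 0 S, Literature.Analysis.FunctionSpaces.Torus.kineticEnergy u₀ + ∫ s in (0:ℝ)..t, ∫ x, inner ℝ (f x) (u s x) ≤ Literature.Analysis.FunctionSpaces.Torus.kineticEnergy (u t) + ν * (∫⁻ s in Set.Ioo 0 t, Literature.Analysis.FunctionSpaces.Torus.eGradNormSq (u s)).toReal + ε := by
  sorry

/-! ## Name-keyed aliases of the three stub statements — the hypotheses of `SingularitiesDissipate_of`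

The native skeleton audit (`#h21_check_skeleton`, run by `ledger skeleton check`) admits a hypothesis of
the composing theorem only if its head constant is a registered obligation or is NAMED like a declared
stub; `__Registered.stub_X` is the statement of `stub_X` verbatim under the stub's short name (device of
`Cruxes/CyclicWindLineLoud/Lines/birth.lean`, `Cruxes/RecurrentDebris/Lines/birth.lean`,
`Cruxes/KolmogorovBlowup/Lines/birth.lean`; the `__` namespace is an implementation detail, so the audit's
stub report resolves each `stub_…` to the sorried theorem above, not to its alias). Each alias is an
`abbrev`, textually its stub's signature. -/
namespace __Registered

/-- Alias of the statement of `stub_maximalLifespan` (maximal lifespan of smooth-forced Euler), keyed by the stub name. -/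
abbrev stub_maximalLifespan : Prop :=
  ∀ f : UnitAddTorus (Fin 3) → EuclideanSpace ℝ (Fin 3), Literature.Analysis.FunctionSpaces.Torus.IsSmooth f → Literature.Analysis.FunctionSpaces.Torus.IsDivFree f → Literature.Analysis.FunctionSpaces.Torus.HasZeroMean f → ∀ (U₀ : UnitAddTorus (Fin 3) → EuclideanSpace ℝ (Fin 3)), Literature.Analysis.FunctionSpaces.Torus.IsSmooth U₀ → Literature.Analysis.FunctionSpaces.Torus.IsDivFree U₀ → ∀ (T : ℝ), 0 < T → (∀ (U : ℝ → UnitAddTorus (Fin 3) → EuclideanSpace ℝ (Fin 3)) (P : ℝ → UnitAddTorus (Fin 3) → ℝ), Literature.Analysis.FunctionSpaces.Torus.IsClassicalNSSolutionOn (Set.Icc 0 T) 0 (fun _ => f) U P → U 0 ≠ U₀) → ∃ Ts : ℝ, 0 < Ts ∧ Ts ≤ T ∧ (∃ (U : ℝ → UnitAddTorus (Fin 3) → EuclideanSpace ℝ (Fin 3)) (P : ℝ → UnitAddTorus (Fin 3) → ℝ), Literature.Analysis.FunctionSpaces.Torus.IsClassicalNSSolutionOn (Set.Ico 0 Ts)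 0 (fun _ => f) U P ∧ U 0 = U₀) ∧ ∀ (V : ℝ → UnitAddTorus (Fin 3) → EuclideanSpace ℝ (Fin 3)) (Q : ℝ → UnitAddTorus (Fin 3) → ℝ), Literature.Analysis.FunctionSpaces.Torus.IsClassicalNSSolutionOn (Set.Icc 0 Ts) 0 (fun _ => f) V Q → V 0 ≠ U₀

/-- Alias of the statement of `stub_blowupDrainsEnergy` (singularities drain energy), keyed by the stub name. -/
abbrev stub_blowupDrainsEnergy : Prop :=
  ∀ f : UnitAddTorus (Fin 3) → EuclideanSpace ℝ (Fin 3), Literature.Analysis.FunctionSpaces.Torus.IsSmooth f → Literature.Analysis.FunctionSpaces.Torus.IsDivFree f → Literature.Analysis.FunctionSpaces.Torus.HasZeroMean f → ∀ (U₀ : UnitAddTorus (Fin 3) → EuclideanSpace ℝ (Fin 3)), Literature.Analysis.FunctionSpaces.Torus.IsSmooth U₀ → Literature.Analysis.FunctionSpaces.Torus.IsDivFree U₀ → ∀ (Ts : ℝ), 0 < Ts → ∀ (U : ℝ → UnitAddTorus (Fin 3) → EuclideanSpace ℝ (Fin 3)) (P : ℝ → UnitAddTorus (Fin 3) → ℝ),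 Literature.Analysis.FunctionSpaces.Torus.IsClassicalNSSolutionOn (Set.Ico 0 Ts) 0 (fun _ => f) U P → U 0 = U₀ → (∀ (V : ℝ → UnitAddTorus (Fin 3) → EuclideanSpace ℝ (Fin 3)) (Q : ℝ → UnitAddTorus (Fin 3) → ℝ), Literature.Analysis.FunctionSpaces.Torus.IsClassicalNSSolutionOn (Set.Icc 0 Ts) 0 (fun _ => f) V Q → V 0 ≠ U₀) → ∃ (q τ ν₀ δ : ℝ), 0 < q ∧ 0 ≤ τ ∧ 0 < ν₀ ∧ 0 < δ ∧ ∀ (ν : ℝ) (u₀ : UnitAddTorus (Fin 3) → EuclideanSpace ℝ (Fin 3)) (u : ℝ → UnitAddTorus (Fin 3) → EuclideanSpace ℝ (Fin 3)), 0 < ν → ν < ν₀ → Literature.Analysis.FluidPDE.Torus.IsGlobalLerayHopf ν (fun _ => f) u₀ u → MeasureTheory.MemLp u₀ 2 MeasureTheory.volume → MeasureTheory.eLpNorm (u₀ - U₀) 2 MeasureTheory.volume ≤ ENNReal.ofReal δ → ∃ t ∈ Set.Icc Ts (Ts + τ), Literature.Analysis.FunctionSpaces.Torus.kineticEnergy (u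 t) + q ≤ Literature.Analysis.FunctionSpaces.Torus.kineticEnergy u₀ + ∫ s in (0:ℝ)..t, ∫ x, inner ℝ (f x) (u s x)

/-- Alias of the statement of `stub_deficitIsViscous` (the drain is viscous: uniform approximate energy equality), keyed by the stub name. -/
abbrev stub_deficitIsViscous : Prop :=
  ∀ f : UnitAddTorus (Fin 3) → EuclideanSpace ℝ (Fin 3), Literature.Analysis.FunctionSpaces.Torus.IsSmooth f → Literature.Analysis.FunctionSpaces.Torus.IsDivFree f → Literature.Analysis.FunctionSpaces.Torus.HasZeroMean f → ∀ (U₀ : UnitAddTorus (Fin 3) → EuclideanSpace ℝ (Fin 3)), Literature.Analysis.FunctionSpaces.Torus.IsSmooth U₀ → Literature.Analysis.FunctionSpaces.Torus.IsDivFree U₀ → ∀ (S : ℝ), 0 < S → ∀ (ε : ℝ), 0 < ε → ∃ (ν₀ δ : ℝ), 0 < ν₀ ∧ 0 < δ ∧ ∀ (ν : ℝ) (u₀ : UnitAddTorus (Fin 3) → EuclideanSpace ℝ (Fin 3)) (u : ℝ → UnitAddTorus (Fin 3) → EuclideanSpace ℝ (Fin 3)), 0 < ν → ν < ν₀ → Literature.Analysis.FluidPDE.Torus.IsGlobalLerayHopf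 ν (fun _ => f) u₀ u → MeasureTheory.MemLp u₀ 2 MeasureTheory.volume → MeasureTheory.eLpNorm (u₀ - U₀) 2 MeasureTheory.volume ≤ ENNReal.ofReal δ → ∀ t ∈ Set.Ioc 0 S, Literature.Analysis.FunctionSpaces.Torus.kineticEnergy u₀ + ∫ s in (0:ℝ)..t, ∫ x, inner ℝ (f x) (u s x) ≤ Literature.Analysis.FunctionSpaces.Torus.kineticEnergy (u t) + ν * (∫⁻ s in Set.Ioo 0 t, Literature.Analysis.FunctionSpaces.Torus.eGradNormSq (u s)).toReal + ε

end __Registered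

/-- **Composition** (kernel-checked, no `sorry` of its own): the three stub statements (as the name-keyed
aliases `__Registered.stub_*`) imply the crux
`Summit.AnomalousDissipation.AnomalousDissipation.Theses.Sparks.SingularitiesDissipate` BY NAME.
Breakdown by `T` ⇒ (stub 1) a maximal classical solution on `[0, T⋆)`, `0 < T⋆ ≤ T`, not continuable to
`[0, T⋆]` ⇒ (stub 2) `q, τ, ν₁, δ₁` and, for each admissible Leray–Hopf solution, a deficit time
`t ∈ [T⋆, T⋆ + τ]` ⇒ (stub 3 on the window `S := T + τ` with tolerance `ε := q/2`, thresholds `ν₂, δ₂`)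
`q/2 ≤ ν ∫₀ᵗ ‖∇u‖₂²` ⇒ monotonicity of the window `(0,t) ⊆ (0,T+τ)` (the larger integral is finite for a
Leray–Hopf solution, `IsLerayHopfOn.lintegral_eGradNormSq_lt_top`). Witnesses of the crux:
`(q/2, τ, min ν₁ ν₂, min δ₁ δ₂)`. [bookkeeping] -/
theorem SingularitiesDissipate_of :
    __Registered.stub_maximalLifespan → __Registered.stub_blowupDrainsEnergy →
      __Registered.stub_deficitIsViscous →
        Summit.AnomalousDissipation.AnomalousDissipation.Theses.Sparks.SingularitiesDissipate := by
  intro hLife hDrain hVisc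
  dsimp only [__Registered.stub_maximalLifespan, __Registered.stub_blowupDrainsEnergy,
    __Registered.stub_deficitIsViscous] at hLife hDrain hVisc
  unfold Summit.AnomalousDissipation.AnomalousDissipation.Theses.Sparks.SingularitiesDissipate
  intro f hf hfd hfm U₀ hU₀ hU₀d T hT hbreak
  -- stub 1: the maximal classical solution `(U, P)` on `[0, Ts)`, `0 < Ts ≤ T`, breaking down at `Ts`
  obtain ⟨Ts, hTs, hTsT, ⟨U, P, hU, hU0⟩, hbreakTs⟩ :=
    hLife f hf hfd hfm U₀ hU₀ hU₀d T hT hbreak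
  -- stub 2: the singularity drains a quantum `q` by some time `t ∈ [Ts, Ts + τ]`
  obtain ⟨q, τ, ν₁, δ₁, hq, hτ, hν₁, hδ₁, hdrain⟩ :=
    hDrain f hf hfd hfm U₀ hU₀ hU₀d Ts hTs U P hU hU0 hbreakTs
  -- stub 3: on the window `S = T + τ`, with tolerance `q / 2`, the drain is viscous
  have hTτ : 0 < T + τ := by linarith
  obtain ⟨ν₂, δ₂, hν₂, hδ₂, hvisc⟩ :=
    hVisc f hf hfd hfm U₀ hU₀ hU₀d (T + τ) hTτ (q / 2) (by linarith)
  refine ⟨q / 2, τ, min ν₁ ν₂, min δ₁ δ₂, by linarith, hτ, lt_min hν₁ hν₂, lt_min hδ₁ hδ₂, ?_⟩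
  intro ν u₀ u hν hνlt hLH hmem hclose
  have hν₁' : ν < ν₁ := lt_of_lt_of_le hνlt (min_le_left _ _)
  have hν₂' : ν < ν₂ := lt_of_lt_of_le hνlt (min_le_right _ _)
  have hclose₁ : MeasureTheory.eLpNorm (u₀ - U₀) 2 MeasureTheory.volume ≤ ENNReal.ofReal δ₁ :=
    hclose.trans (ENNReal.ofReal_le_ofReal (min_le_left _ _))
  have hclose₂ : MeasureTheory.eLpNorm (u₀ - U₀) 2 MeasureTheory.volume ≤ ENNReal.ofReal δ₂ :=
    hclose.trans (ENNReal.ofReal_le_ofReal (min_le_right _ _))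
  -- the deficit time of this solution
  obtain ⟨t, ht, hdef⟩ := hdrain ν u₀ u hν hν₁' hLH hmem hclose₁
  have ht0 : 0 < t := lt_of_lt_of_le hTs ht.1
  have htS : t ≤ T + τ := by linarith [ht.2]
  -- approximate energy equality at the deficit time
  have heq := hvisc ν u₀ u hν hν₂' hLH hmem hclose₂ t ⟨ht0, htS⟩
  -- the dissipation integral is monotone in the window and finite on `(0, T + τ)` (Leray–Hopf ⇒ `L²H¹`)
  have hfin : (∫⁻ s in Set.Ioo 0 (T + τ), Literature.Analysis.FunctionSpaces.Torus.eGradNormSq (u s)) ≠ ⊤ :=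
    ((hLH.isLerayHopfOn hTτ).lintegral_eGradNormSq_lt_top).ne
  have hmono : (∫⁻ s in Set.Ioo 0 t, Literature.Analysis.FunctionSpaces.Torus.eGradNormSq (u s)).toReal ≤
      (∫⁻ s in Set.Ioo 0 (T + τ), Literature.Analysis.FunctionSpaces.Torus.eGradNormSq (u s)).toReal :=
    ENNReal.toReal_mono hfin (MeasureTheory.lintegral_mono_set (Set.Ioo_subset_Ioo le_rfl htS))
  have hνB : ν * (∫⁻ s in Set.Ioo 0 t, Literature.Analysis.FunctionSpaces.Torus.eGradNormSq (u s)).toReal ≤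
      ν * (∫⁻ s in Set.Ioo 0 (T + τ), Literature.Analysis.FunctionSpaces.Torus.eGradNormSq (u s)).toReal :=
    mul_le_mul_of_nonneg_left hmono hν.le
  linarith

/-- **The skeleton in its final shape** (D-0027 §3.3): the crux BY NAME from the three registered stubs,
through the sorry-free composition `SingularitiesDissipate_of`; it becomes the crux proof when the last
`stub_*` is discharged (until then it depends on `sorryAx` through the stubs ONLY — no `sorry` of its own).
This file lives under `Cruxes/…/Lines/` (elaborated, never built or imported), so no BC probe can reach this
constant by `exact?`; the BC3 probes of this line import only the route file. -/
theorem SingularitiesDissipate_skeleton :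
    Summit.AnomalousDissipation.AnomalousDissipation.Theses.Sparks.SingularitiesDissipate :=
  SingularitiesDissipate_of stub_maximalLifespan stub_blowupDrainsEnergy stub_deficitIsViscous

end Summit.AnomalousDissipation.AnomalousDissipation.Cruxes.SingularitiesDissipate.Birth

end
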